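import Literature.NumberTheory.EllipticCurves.HidaFamilyGaloisRepDatum
import Mathlib.RingTheory.PowerSeries.Ideal
import Mathlib.RingTheory.Ideal.KrullsHeightTheorem
import Mathlib.RingTheory.Ideal.GoingDown
import HarnessLib

/-!
# Height-one primes of `A⟦X⟧` contract to `⊥` or to height-one primes of `A` (noetherian domain `A`)

Helper for crux stmt-BirchSwinnertonDyer-20547 `KatoDivisibilityX9`, line `prime_adapted_tau` (road (iv),
`Cruxes/KatoDivisibilityX9/Lines/prime_adapted_tau.lean` v4.4, §3 `HeightOneContractionProof`): the hypothesis (HC)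
«every height-one prime `𝔩 ⊂ 𝕀⟦T⟧` contracts to `⊥` or to a height-one prime of `𝕀`» of the structural good Hida datum
is a THEOREM for every noetherian domain `𝕀`, in particular for every coefficient ring module-finite over
`Λ = ℤ_p⟦X⟧`.  Landed tree-side (verbatim the host's lemma file `HOME/imc/g20/HeightOneContraction.lean` v1.1,
planner-bsd-f3-mu-imc-g20-0, with the auxiliary predicate unfolded) so that a later revision of the line can import it
instead of carrying the proof inline.  Pure commutative algebra; nothing about elliptic curves is asserted.

Proof: going down holds for `A → A⟦X⟧` (`A` noetherian) with the explicit witness `p⟦X⟧ᵉ := ker (A⟦X⟧ → (A⧸p)⟦X⟧)`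
(prime, lies over `p`, and `≤ Q` whenever `p ≤ Q ∩ A` because `p` is finitely generated), so
`ht(𝔩 ∩ A) ≤ ht 𝔩 = 1` (`Ideal.height_eq_height_add_of_liesOver_of_hasGoingDown`), and a nonzero prime of a domain
has height `≥ 1`.

References: Matsumura, *Commutative Ring Theory*, Thm. 9.5 and Ex. 9.9 (going down for flat extensions), Thm. 15.1;
Bourbaki AC VII §1. [cite: Matsumura1987, Thm. 9.5 / Ex. 9.9 / Thm. 15.1]
-/

-- the summit and its single problem are both named `BirchSwinnertonDyer` (registry layout D-0017)
set_option linter.dupNamespace false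

namespace Summit.BirchSwinnertonDyer.BirchSwinnertonDyer.Theorems.OneSidedTwistSqueezeX9KatoDivisibilityX9HeightOneContraction

open PowerSeries Literature.NumberTheory.EllipticCurves

noncomputable section

variable {A : Type} [CommRing A]

/-- Membership in `p⟦X⟧ᵉ := ker (A⟦X⟧ → (A ⧸ p)⟦X⟧)`: all coefficients lie in `p`. [folklore] -/
theorem mem_ker_map_mk_iff (p : Ideal A) (f : PowerSeries A) :
    f ∈ RingHom.ker (PowerSeries.map (Ideal.Quotient.mk p)) ↔ ∀ n, coeff n f ∈ p := by
  simp only [RingHom.mem_ker, PowerSeries.ext_iff, coeff_map, map_zero, Ideal.Quotient.eq_zero_iff_mem]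

/-- `p⟦X⟧ᵉ` is prime for `p` prime (kernel of a map to the domain `(A ⧸ p)⟦X⟧`). [folklore] -/
theorem ker_map_mk_isPrime (p : Ideal A) [p.IsPrime] :
    (RingHom.ker (PowerSeries.map (Ideal.Quotient.mk p))).IsPrime :=
  RingHom.ker_isPrime _

/-- `p⟦X⟧ᵉ ∩ A = p` (the contraction along the constants `C : A → A⟦X⟧`). [folklore] -/
theorem comap_C_ker_map_mk (p : Ideal A) :
    Ideal.comap (PowerSeries.C : A →+* PowerSeries A) (RingHom.ker (PowerSeries.map (Ideal.Quotient.mk p))) = p := by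
  ext x
  simp only [Ideal.mem_comap, mem_ker_map_mk_iff, coeff_C]
  constructor
  · intro h; simpa using h 0
  · intro h n; split_ifs <;> simp [h]

/-- `p⟦X⟧ᵉ` lies over `p` for the algebra structure `A → A⟦X⟧`. [folklore] -/
theorem under_ker_map_mk (p : Ideal A) :
    (RingHom.ker (PowerSeries.map (Ideal.Quotient.mk p))).under A = p := by
  rw [Ideal.under_def, PowerSeries.algebraMap_eq]; exact comap_C_ker_map_mk p

/-- If `p` is finitely generated and the constants `C a`, `a ∈ p`, lie in `Q`, then every power series with
coefficients in `p` lies in `Q` (write `f = ∑_{a ∈ s} C a · g_a` coefficientwise). [folklore] -/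
theorem ker_map_mk_le_of_fg {p : Ideal A} (hp : p.FG) {Q : Ideal (PowerSeries A)}
    (hQ : p ≤ Ideal.comap (PowerSeries.C : A →+* PowerSeries A) Q) :
    RingHom.ker (PowerSeries.map (Ideal.Quotient.mk p)) ≤ Q := by
  obtain ⟨s, hs⟩ := hp
  intro f hf
  rw [mem_ker_map_mk_iff] at hf
  have hc : ∀ n, ∃ c : s → A, ∑ a : s, c a • (a : A) = coeff n f := fun n =>
    Submodule.mem_span_finset'.1 (hs ▸ hf n : coeff n f ∈ Ideal.span (s : Set A))
  choose c hc using hc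
  have hf' : f = ∑ a : s, PowerSeries.C (a : A) * PowerSeries.mk (fun n => c n a) := by
    ext n
    simp only [map_sum, coeff_C_mul, coeff_mk, ← hc n, smul_eq_mul]
    exact Finset.sum_congr rfl fun a _ => mul_comm _ _
  rw [hf']
  refine Ideal.sum_mem _ fun a _ => Ideal.mul_mem_right _ _ ?_
  have : (a : A) ∈ p := hs ▸ Ideal.subset_span a.2
  exact hQ this

/-- **Going down for `A → A⟦X⟧`, `A` noetherian**: below `Q ⊇ p A⟦X⟧` the prime `p⟦X⟧ᵉ` lies over `p`.
[cite: Matsumura1987, Thm. 9.5 / Ex. 9.9] -/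
theorem hasGoingDown_powerSeries [IsNoetherianRing A] : Algebra.HasGoingDown A (PowerSeries A) := by
  constructor
  intro p _ Q _ hlt
  refine ⟨RingHom.ker (PowerSeries.map (Ideal.Quotient.mk p)), ?_, ker_map_mk_isPrime p, ⟨(under_ker_map_mk p).symm⟩⟩
  refine ker_map_mk_le_of_fg (IsNoetherian.noetherian p) ?_
  have h := hlt.le
  rw [Ideal.under_def, PowerSeries.algebraMap_eq] at h
  exact h

/-- **Height-one primes of `A⟦X⟧` contract to `⊥` or to height-one primes of `A`** for every noetherian domain `A`:
`ht(𝔩 ∩ A) ≤ ht 𝔩 = 1` by going down, and a nonzero prime of a domain has height `≥ 1`.  Conclusion spelled with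
`HidaFamilyGaloisRepDatum.heightOnePrimes` (= `{P | P.IsPrime ∧ P.height = 1}`), the currency of road (iv).
[cite: Matsumura1987, Thm. 15.1] -/
theorem comap_C_eq_bot_or_mem_heightOnePrimes_of_isNoetherianRing (A : Type) [CommRing A] [IsDomain A]
    [IsNoetherianRing A] (𝔩 : PrimeSpectrum (PowerSeries A)) (h𝔩 : 𝔩.asIdeal.height = 1) :
    Ideal.comap (PowerSeries.C : A →+* PowerSeries A) 𝔩.asIdeal = ⊥ ∨
      Ideal.comap (PowerSeries.C : A →+* PowerSeries A) 𝔩.asIdeal ∈ HidaFamilyGaloisRepDatum.heightOnePrimes A := by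
  haveI := hasGoingDown_powerSeries (A := A)
  set P : Ideal A := Ideal.comap (PowerSeries.C : A →+* PowerSeries A) 𝔩.asIdeal with hPdef
  have hPu : P = 𝔩.asIdeal.under A := by rw [Ideal.under_def, PowerSeries.algebraMap_eq]
  haveI hPprime : P.IsPrime := Ideal.IsPrime.comap _
  by_cases hP : P = ⊥
  · exact Or.inl hP
  · right
    rw [HidaFamilyGaloisRepDatum.mem_heightOnePrimes_iff]
    refine ⟨hPprime, le_antisymm ?_ ?_⟩
    · haveI : 𝔩.asIdeal.LiesOver P := ⟨hPu⟩
      have h := Ideal.height_eq_height_add_of_liesOver_of_hasGoingDown P 𝔩.asIdeal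
      have : P.height ≤ 𝔩.asIdeal.height := h ▸ le_self_add
      exact this.trans h𝔩.le
    · have h0 : P.height ≠ 0 := fun h0 => hP ((Ideal.height_eq_zero_iff_eq_bot).1 h0)
      exact Order.one_le_iff_ne_zero.2 h0

/-- **The same for every coefficient domain module-finite over `Λ = ℤ_p⟦X⟧`** (a Hida datum's `𝕀`), which is
noetherian by `IsNoetherianRing.of_finite`. [cite: Matsumura1987, Thm. 15.1] -/
theorem comap_C_eq_bot_or_mem_heightOnePrimes_of_moduleFinite (p : ℕ) [Fact p.Prime] (I : Type) [CommRing I]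
    [IsDomain I] [Algebra (IwasawaAlgebra p) I] [Module.Finite (IwasawaAlgebra p) I]
    (𝔩 : PrimeSpectrum (PowerSeries I)) (h𝔩 : 𝔩.asIdeal.height = 1) :
    Ideal.comap (PowerSeries.C : I →+* PowerSeries I) 𝔩.asIdeal = ⊥ ∨
      Ideal.comap (PowerSeries.C : I →+* PowerSeries I) 𝔩.asIdeal ∈ HidaFamilyGaloisRepDatum.heightOnePrimes I := by
  haveI : IsNoetherianRing I := IsNoetherianRing.of_finite (IwasawaAlgebra p) I
  exact comap_C_eq_bot_or_mem_heightOnePrimes_of_isNoetherianRing I 𝔩 h𝔩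

end

end Summit.BirchSwinnertonDyer.BirchSwinnertonDyer.Theorems.OneSidedTwistSqueezeX9KatoDivisibilityX9HeightOneContraction
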